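import Summits.Langlands.Langlands.Theses.BaseFieldAscent

/-!
# Repair sketch for `BaseFieldAscent.closes` after the statement re-type p141787 (NOT an edit; advice
for the route-repair / tenure seat). Two variants, both elaborated here against the CURRENT tree.

(ii) keep the `∃ R`-shaped items, ADD one item `DatumRigidity` (independence of the reciprocity datum:
Henniart uniqueness of `rec_v` on the classes the summit uses, in the tree's typing — substantive; if it
FAILS as typed then the re-typed `∀ 𝓡` summit is itself refutable, cf. Statement docstring / D-0032 Q-L1),
and re-glue: `closes (h₁ h₂ h₃) (h₄ : DatumRigidity) : Langlands`.
(i) lockstep (human Q-L2): re-type ReciprocityTRCM / AscentConjugationSolvable / AscentResidual to the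
`Nonempty ∧ ∀ 𝓡` shape; `closes := h₃ (h₂ h₁)` unchanged. Shown as primed defs.
-/

namespace Summit.Langlands.Langlands.Theses.BaseFieldAscent.RepairSketch
open Summit.Langlands.Langlands.Theses.BaseFieldAscent

/-- (ii) the one new item. [folklore] -/
def DatumRigidity : Prop :=
  ∀ (F : Type) [Field F] [NumberField F] (R R' : ReciprocityData F) (n : ℕ), 0 < n →
    ∀ hcpt : Literature.NumberTheory.Automorphic.isCompact_glFiniteIntegralLevel n F,
      GlobalLanglandsCorrespondenceGLn n F R hcpt → GlobalLanglandsCorrespondenceGLn n F R' hcpt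

/-- (ii) the re-glued deciding theorem: elaborates against the NEW summit. -/
theorem closes_ii (h₁ : ReciprocityTRCM) (h₂ : AscentConjugationSolvable) (h₃ : AscentResidual)
    (h₄ : DatumRigidity) : _root_.Langlands := by
  intro F _ _
  obtain ⟨R, hR⟩ := h₃ (h₂ h₁) F
  exact ⟨⟨R⟩, fun 𝓡 n hn hcpt => h₄ F R 𝓡 n hn hcpt (hR n hn hcpt)⟩

/-- (i) lockstep re-type of the deciding crux. [folklore] -/
def ReciprocityTRCM' : Prop :=
  ∀ (F : Type) [Field F] [NumberField F], (NumberField.IsTotallyReal F ∨ NumberField.IsCMField F) →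
    Nonempty (ReciprocityData F) ∧ ∀ (R : ReciprocityData F) (n : ℕ), 0 < n →
      ∀ hcpt : Literature.NumberTheory.Automorphic.isCompact_glFiniteIntegralLevel n F,
        GlobalLanglandsCorrespondenceGLn n F R hcpt

/-- (i) conjugation-solvable predicate, verbatim from the route. [folklore] -/
def IsConjSolvable (F : Type) [Field F] [NumberField F] : Prop :=
  ∃ (F₀ E : Type) (_ : Field F₀) (_ : NumberField F₀) (_ : Field E) (_ : NumberField E) (_ : Algebra F₀ F)
    (_ : Algebra F E) (_ : Algebra F₀ E) (_ : IsScalarTower F₀ F E) (_ : IsGalois F₀ E),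
    NumberField.IsTotallyReal F₀ ∧ IsSolvable (E ≃ₐ[F₀] E)

/-- (i) lockstep AscentConjugationSolvable'. [folklore] -/
def AscentConjugationSolvable' : Prop :=
  ReciprocityTRCM' → ∀ (F : Type) [Field F] [NumberField F], IsConjSolvable F →
    Nonempty (ReciprocityData F) ∧ ∀ (R : ReciprocityData F) (n : ℕ), 0 < n →
      ∀ hcpt : Literature.NumberTheory.Automorphic.isCompact_glFiniteIntegralLevel n F,
        GlobalLanglandsCorrespondenceGLn n F R hcpt

/-- (i) lockstep AscentResidual'. [folklore] -/
def AscentResidual' : Prop :=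
  (∀ (F : Type) [Field F] [NumberField F], IsConjSolvable F →
    Nonempty (ReciprocityData F) ∧ ∀ (R : ReciprocityData F) (n : ℕ), 0 < n →
      ∀ hcpt : Literature.NumberTheory.Automorphic.isCompact_glFiniteIntegralLevel n F,
        GlobalLanglandsCorrespondenceGLn n F R hcpt) →
  ∀ (F : Type) [Field F] [NumberField F],
    Nonempty (ReciprocityData F) ∧ ∀ (R : ReciprocityData F) (n : ℕ), 0 < n →
      ∀ hcpt : Literature.NumberTheory.Automorphic.isCompact_glFiniteIntegralLevel n F,
        GlobalLanglandsCorrespondenceGLn n F R hcpt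

/-- (i) the unchanged glue elaborates against the NEW summit. -/
theorem closes_i (h₁ : ReciprocityTRCM') (h₂ : AscentConjugationSolvable') (h₃ : AscentResidual') :
    _root_.Langlands :=
  h₃ (h₂ h₁)

/-- Under (i) the strategist's split survives with the same three `∃`-pieces PLUS `DatumRigidity`
restricted to TR/CM fields (or with the pieces re-typed in lockstep): `∃`-reciprocity over TR∪CM and
rigidity give the `∀ 𝓡` form. -/
theorem reciprocityTRCM'_of (h : ReciprocityTRCM) (h₄ : DatumRigidity) : ReciprocityTRCM' := by
  intro F _ _ hF
  obtain ⟨R, hR⟩ := h F hF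
  exact ⟨⟨R⟩, fun 𝓡 n hn hcpt => h₄ F R 𝓡 n hn hcpt (hR n hn hcpt)⟩

/-- And the new summit still gives the old crux (corollary direction, as in the PhantomRM atlas). -/
theorem reciprocityTRCM_of_langlands (hL : _root_.Langlands) : ReciprocityTRCM :=
  fun F _ _ _ => (hL F).1.elim fun R => ⟨R, (hL F).2 R⟩

end Summit.Langlands.Langlands.Theses.BaseFieldAscent.RepairSketch
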